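import Summits.BirchSwinnertonDyer.BirchSwinnertonDyer.Theorems.AlignedTransportAtTwoOffStratumPartitionTwistFamilyZhaiTransportSeeds
import Summits.BirchSwinnertonDyer.BirchSwinnertonDyer.Theorems.TwoAdicConverseFrobeniusParityTwoDivisionRoot
import HarnessLib

/-!
# Route `AlignedTransportAtTwo`, crux C2 `MainConjectureOfRankZeroBSDAtTwo` (stmt-22298), line `birth` — THE `a_q`-ODD TWIST CLASSES OF `4087a1` AND `4087c1` (`N = 61·67`; the two seeds have the SAME cubic `2`-torsion field, hence the same `a_q`-odd primes):
# MEMBERSHIP BY ONE `decide` and explicit prime-star members with `BSD(W, 2)` by print-transport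

HONEST FRAMING (cell `bsd-f1-sign2`, WIDTH-5 attach seat `bsd-line-att-p4` g25; `--supports stmt-BirchSwinnertonDyer-22298 --as helper`).
THEOREMS ONLY (no `def`, no named fact, no `sorry`). BSD is NOT proved; nothing is asserted — every row is CONDITIONAL on the displayed PRINT
named facts and the two displayed data of the seed (`Dt` optimality datum, `hL : ord₂ L(S,1)/Ω = 0`). Twin of att-p4 g24's `…TwistFamilyZhaiTransportMembers`
(`1727a1`, p752995) and of this seat's `…Members2071a1`: g24's successor item (d). The print-transport rows `bsdp_two_twist_oddTrace_<seed>` are g24's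
(`…ZhaiTransportSeeds`, p751625).

WHAT. Per seed `S`: `integralModelInt_b_S` (the `b`-invariants of Cremona's model), **`odd_frobeniusTrace_S_of_forall_ne_zero`** (`q` odd, `q ∤ N`, the
`2`-division cubic `4x³ + b₂x² + 2b₄x + b₆` has no root mod `q` ⟹ `a_q(S)` odd — tree dictionary `TwoAdicTwistConverse.odd_frobeniusTrace_iff_forall_ne_zero`), the
no-root certificates `forall_ne_zero_S_q` (`decide +kernel`), **`bsdp_two_twist_S_primeStar_of_forall_ne_zero`** (every globally minimal model `W` of `S^{(±q)}`,
`±q ≡ 1 (mod 4)`: `r_an = 0 ∧ rank 0 ∧ Ш[2^∞] = 0 ∧ c` odd `∧ BSD(W,2)` modulo PRINT⁷ + {`Dt`, `hL`}), and the members by `decide`: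
`4087a1^{(d)}` and `4087c1^{(d)}` for `d = −7, −11, −19, −31, −43, 53` (conductors `4087·d²` from `200 263` to `11 480 383`).

PARTITION CURRENCY (D-0171): unchanged (members of the (T) twist-family row of the rank-zero leaf, PRINT-TRANSPORT by p750624/p751625); the membership TEST
of `T_Z(S)` is now a kernel `decide` for every small seed of the cell. Beyond-print theorem: no. BSD is NOT proved.

References: [Zhai2016] Thm. 1.1; [MazurRubin2010] Lemma 2.10; [AbbesUllmo1996] Thm. A; [CreutzMiller2012] Thm. 1.1; [Miller2011LMS] Def. 1.1;
[CremonaAlgorithms1997] Table 1; [SilvermanAEC2009] III.2.3, V.2.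
-/

set_option autoImplicit false
set_option linter.dupNamespace false

noncomputable section

open scoped Classical

open WeierstrassCurve NumberField
open Literature.NumberTheory.EllipticCurves Literature.NumberTheory.EllipticCurves.ModularForms
open Literature.NumberTheory.EllipticCurves.Rank1Residual Literature.NumberTheory.EllipticCurves.Rank1Residual.Typed
open Literature.NumberTheory.EllipticCurves.CoatesLiTianZhai2015 Literature.NumberTheory.EllipticCurves.Zhai2016
open Summit.BirchSwinnertonDyer.Rank1Residual Summit.BirchSwinnertonDyer.Rank1Residual.X5
open Summit.BirchSwinnertonDyer.Uniform
open Summit.BirchSwinnertonDyer.BirchSwinnertonDyer.Theorems.TowerClass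
open Summit.BirchSwinnertonDyer.BirchSwinnertonDyer.Theorems.AlignedTransportAtTwoTwistFamilySmallSeeds
open Summit.BirchSwinnertonDyer.BirchSwinnertonDyer.Theorems.AlignedTransportAtTwoTwistFamilyZhaiTransport
open Summit.BirchSwinnertonDyer.BirchSwinnertonDyer.Theorems.AlignedTransportAtTwoTwistFamilyZhaiTransportSeeds
open Summit.BirchSwinnertonDyer.BirchSwinnertonDyer.Theorems

namespace Summit.BirchSwinnertonDyer.BirchSwinnertonDyer.Theorems.AlignedTransportAtTwoTwistFamilyZhaiTransportMembers4087

/-! ## `4087a1` (`N = 4087`, model `[1, 0, 0, −37497, −2922032]`): `a_q` odd from «no root of `4x³ + 1x² − 149988x − 11688128` mod `q`» -/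

/-- The `b`-invariants of the integral model of `4087a1`: `b₂ = 1`, `b₄ = -74994`, `b₆ = -11688128`. [cite: CremonaAlgorithms1997, Table 1] -/
theorem integralModelInt_b_4087a1 : (integralModelInt c4087a1).b₂ = 1 ∧ (integralModelInt c4087a1).b₄ = -74994 ∧
    (integralModelInt c4087a1).b₆ = -11688128 := by
  have h : integralModelInt c4087a1 = M4087a1 := Instances.integralModelInt_baseChange_int M4087a1
  rw [h]
  exact ⟨by decide, by decide, by decide⟩

/-- **`a_q(4087a1)` odd from one `decide`**: for an odd prime `q ∤ 4087`, if `4x³ + 1x² − 149988x − 11688128` has no root in `ℤ/q` then `a_q(4087a1)` is odd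
(tree dictionary `TwoAdicTwistConverse.odd_frobeniusTrace_iff_forall_ne_zero`; good reduction at `q ∤ N = 4087`). [cite: SilvermanAEC2009, III.2.3 and V.2] -/
theorem odd_frobeniusTrace_4087a1_of_forall_ne_zero {q : ℕ} [Fact q.Prime] (hq2 : q ≠ 2) (hqN : ¬ q ∣ 4087)
    (hno : ∀ x : ZMod q, 4 * x ^ 3 + 1 * x ^ 2 - 149988 * x - 11688128 ≠ 0) : Odd (c4087a1.frobeniusTrace q) := by
  have hgood : c4087a1.HasGoodReductionAtPrime q := by
    by_contra h
    exact hqN (by rw [← conductorNorm_4087a1]; exact (c4087a1.dvd_conductorNorm_iff_not_hasGoodReductionAtPrime q).mpr h)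
  rw [TwoAdicTwistConverse.odd_frobeniusTrace_iff_forall_ne_zero c4087a1 q hq2 hgood, integralModelInt_b_4087a1.1,
    integralModelInt_b_4087a1.2.1, integralModelInt_b_4087a1.2.2]
  intro x
  have h := hno x
  push_cast
  intro h'
  apply h
  linear_combination h'

/-- No root of `4x³ + 1x² − 149988x − 11688128` mod `7` (so `a_{7}(4087a1)` is odd). [cite: CremonaAlgorithms1997, Table 1] -/
theorem forall_ne_zero_4087a1_7 : ∀ x : ZMod 7, 4 * x ^ 3 + 1 * x ^ 2 - 149988 * x - 11688128 ≠ 0 := by decide +kernel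

/-- No root of `4x³ + 1x² − 149988x − 11688128` mod `11` (so `a_{11}(4087a1)` is odd). [cite: CremonaAlgorithms1997, Table 1] -/
theorem forall_ne_zero_4087a1_11 : ∀ x : ZMod 11, 4 * x ^ 3 + 1 * x ^ 2 - 149988 * x - 11688128 ≠ 0 := by decide +kernel

/-- No root of `4x³ + 1x² − 149988x − 11688128` mod `19` (so `a_{19}(4087a1)` is odd). [cite: CremonaAlgorithms1997, Table 1] -/
theorem forall_ne_zero_4087a1_19 : ∀ x : ZMod 19, 4 * x ^ 3 + 1 * x ^ 2 - 149988 * x - 11688128 ≠ 0 := by decide +kernel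

/-- No root of `4x³ + 1x² − 149988x − 11688128` mod `31` (so `a_{31}(4087a1)` is odd). [cite: CremonaAlgorithms1997, Table 1] -/
theorem forall_ne_zero_4087a1_31 : ∀ x : ZMod 31, 4 * x ^ 3 + 1 * x ^ 2 - 149988 * x - 11688128 ≠ 0 := by decide +kernel

/-- No root of `4x³ + 1x² − 149988x − 11688128` mod `43` (so `a_{43}(4087a1)` is odd). [cite: CremonaAlgorithms1997, Table 1] -/
theorem forall_ne_zero_4087a1_43 : ∀ x : ZMod 43, 4 * x ^ 3 + 1 * x ^ 2 - 149988 * x - 11688128 ≠ 0 := by decide +kernel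

/-- No root of `4x³ + 1x² − 149988x − 11688128` mod `53` (so `a_{53}(4087a1)` is odd). [cite: CremonaAlgorithms1997, Table 1] -/
theorem forall_ne_zero_4087a1_53 : ∀ x : ZMod 53, 4 * x ^ 3 + 1 * x ^ 2 - 149988 * x - 11688128 ≠ 0 := by decide +kernel

section Members4087a1

variable (W : WeierstrassCurve ℚ) [W.IsElliptic] [W.IsGloballyMinimal]
  (h11 : thm11_ordTwo_LAlg_twist_eq_zero') (h12 : thm12_ordTwo_LAlg_twist_eq_one')
  (hMR' : MazurRubin2010.d2_eq_of_lemma210_rat) (hmod : exists_isNewformOf)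
  (hAU : abbesUllmo_not_dvd_maninConstant_of_not_dvd_level)
  (hCM : bsdTriple_of_rank_le_one_of_conductor_lt) (hGZK : rank_eq_analyticRank_of_analyticRank_le_one)

include h11 h12 hMR' hmod hAU hCM hGZK in
/-- **`BSD(W, 2)` by PRINT-TRANSPORT for every globally minimal model `W` of `4087a1^{(d)}`, `d = ±q` a prime-star** (`q` an odd prime, `q ∤ 4087`,
`d ∈ {q, −q}` with `d ≡ 1 (mod 4)`, and `4x³ + 1x² − 149988x − 11688128` without root mod `q` — i.e. `a_q(4087a1)` odd, one `decide`): `r_an(W) = 0 ∧ rank 0 ∧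
Ш(W)[2^∞] = 0 ∧ c(W)` odd `∧ BSD(W, 2)`, modulo PRINT⁷ {Zhai 1.1′/1.2′, Mazur–Rubin L. 2.10, modularity, Abbes–Ullmo, Creutz–Miller, GZK} +
displayed {`Dt`, `hL`} of `4087a1`. No Kato, no certificate. CONDITIONAL; BSD is NOT proved. [cite: Zhai2016, Thm. 1.1]
[cite: MazurRubin2010, Lemma 2.10] [cite: CreutzMiller2012, Thm. 1.1] [cite: AbbesUllmo1996, Thm. A] [cite: Miller2011LMS, Def. 1.1] -/
theorem bsdp_two_twist_4087a1_primeStar_of_forall_ne_zero [NeZero (c4087a1.conductorNorm ℤ)]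
    (Dt : ModularParametrizationData c4087a1 (c4087a1.conductorNorm ℤ)) (hopt : Zhai2021.IsOptimalDatum c4087a1 Dt)
    (hL : ∃ x : ℚ, IsLAlg c4087a1 x ∧ x ≠ 0 ∧ padicValRat 2 x = 0)
    {q : ℕ} [Fact q.Prime] (hq2 : q ≠ 2) (hqN : ¬ q ∣ 4087) (hno : ∀ x : ZMod q, 4 * x ^ 3 + 1 * x ^ 2 - 149988 * x - 11688128 ≠ 0)
    {d : ℤ} (hd : d = q ∨ d = -q) (hd4 : d % 4 = 1)
    {c : VariableChange ℚ} (hc : c • c4087a1.quadraticTwist (d : ℚ) = W) :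
    W.analyticRank = 0 ∧ W.mordellWeilRank = 0 ∧ AddCommGroup.primaryComponent W.sha 2 = ⊥ ∧ Odd W.tamagawaProduct ∧ BSDp W 2 := by
  have hq : q.Prime := Fact.out
  have hdabs : d.natAbs = q := by rcases hd with rfl | rfl <;> simp
  have hsqf : Squarefree d := by
    rw [← Int.squarefree_natAbs, hdabs]; exact hq.squarefree
  have hd1 : d ≠ 1 := by
    rintro rfl
    rw [Int.natAbs_one] at hdabs
    exact hq.one_lt.ne hdabs
  have hgcd : Int.gcd d 4087 = 1 := by
    rw [Int.gcd_eq_natAbs, hdabs]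
    exact (Nat.Prime.coprime_iff_not_dvd hq).mpr hqN
  refine bsdp_two_twist_oddTrace_4087a1 W h11 h12 hMR' hmod hAU hCM hGZK Dt hopt hL hsqf hd1 hd4 hgcd (fun p hp hpd ↦ ?_) hc
  have hpq : p = q := by
    have h1 : p ∣ d.natAbs := Int.natCast_dvd.mp hpd
    rw [hdabs] at h1
    exact (Nat.prime_dvd_prime_iff_eq hp hq).mp h1
  subst hpq
  exact odd_frobeniusTrace_4087a1_of_forall_ne_zero hq2 hqN hno

include h11 h12 hMR' hmod hAU hCM hGZK in
/-- **`BSD(W, 2)` by print-transport for every globally minimal model of `4087a1^{(-7)}`** (`N = 200 263`; no root mod `7`, `decide`). CONDITIONAL;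
BSD is NOT proved. [cite: Zhai2016, Thm. 1.1] [cite: MazurRubin2010, Lemma 2.10] [cite: CreutzMiller2012, Thm. 1.1] [cite: Miller2011LMS, Def. 1.1] -/
theorem bsdp_two_twist_4087a1_neg7 [NeZero (c4087a1.conductorNorm ℤ)]
    (Dt : ModularParametrizationData c4087a1 (c4087a1.conductorNorm ℤ)) (hopt : Zhai2021.IsOptimalDatum c4087a1 Dt)
    (hL : ∃ x : ℚ, IsLAlg c4087a1 x ∧ x ≠ 0 ∧ padicValRat 2 x = 0)
    {c : VariableChange ℚ} (hc : c • c4087a1.quadraticTwist ((-7 : ℤ) : ℚ) = W) : BSDp W 2 :=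
  haveI : Fact (Nat.Prime 7) := ⟨by norm_num⟩
  (bsdp_two_twist_4087a1_primeStar_of_forall_ne_zero W h11 h12 hMR' hmod hAU hCM hGZK Dt hopt hL (q := 7) (by norm_num) (by norm_num)
    forall_ne_zero_4087a1_7 (Or.inr (by norm_num)) (by decide) hc).2.2.2.2

include h11 h12 hMR' hmod hAU hCM hGZK in
/-- **`BSD(W, 2)` by print-transport for every globally minimal model of `4087a1^{(-11)}`** (`N = 494 527`; no root mod `11`, `decide`). CONDITIONAL;
BSD is NOT proved. [cite: Zhai2016, Thm. 1.1] [cite: MazurRubin2010, Lemma 2.10] [cite: CreutzMiller2012, Thm. 1.1] [cite: Miller2011LMS, Def. 1.1] -/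
theorem bsdp_two_twist_4087a1_neg11 [NeZero (c4087a1.conductorNorm ℤ)]
    (Dt : ModularParametrizationData c4087a1 (c4087a1.conductorNorm ℤ)) (hopt : Zhai2021.IsOptimalDatum c4087a1 Dt)
    (hL : ∃ x : ℚ, IsLAlg c4087a1 x ∧ x ≠ 0 ∧ padicValRat 2 x = 0)
    {c : VariableChange ℚ} (hc : c • c4087a1.quadraticTwist ((-11 : ℤ) : ℚ) = W) : BSDp W 2 :=
  haveI : Fact (Nat.Prime 11) := ⟨by norm_num⟩
  (bsdp_two_twist_4087a1_primeStar_of_forall_ne_zero W h11 h12 hMR' hmod hAU hCM hGZK Dt hopt hL (q := 11) (by norm_num) (by norm_num)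
    forall_ne_zero_4087a1_11 (Or.inr (by norm_num)) (by decide) hc).2.2.2.2

include h11 h12 hMR' hmod hAU hCM hGZK in
/-- **`BSD(W, 2)` by print-transport for every globally minimal model of `4087a1^{(-19)}`** (`N = 1 475 407`; no root mod `19`, `decide`). CONDITIONAL;
BSD is NOT proved. [cite: Zhai2016, Thm. 1.1] [cite: MazurRubin2010, Lemma 2.10] [cite: CreutzMiller2012, Thm. 1.1] [cite: Miller2011LMS, Def. 1.1] -/
theorem bsdp_two_twist_4087a1_neg19 [NeZero (c4087a1.conductorNorm ℤ)]
    (Dt : ModularParametrizationData c4087a1 (c4087a1.conductorNorm ℤ)) (hopt : Zhai2021.IsOptimalDatum c4087a1 Dt)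
    (hL : ∃ x : ℚ, IsLAlg c4087a1 x ∧ x ≠ 0 ∧ padicValRat 2 x = 0)
    {c : VariableChange ℚ} (hc : c • c4087a1.quadraticTwist ((-19 : ℤ) : ℚ) = W) : BSDp W 2 :=
  haveI : Fact (Nat.Prime 19) := ⟨by norm_num⟩
  (bsdp_two_twist_4087a1_primeStar_of_forall_ne_zero W h11 h12 hMR' hmod hAU hCM hGZK Dt hopt hL (q := 19) (by norm_num) (by norm_num)
    forall_ne_zero_4087a1_19 (Or.inr (by norm_num)) (by decide) hc).2.2.2.2

include h11 h12 hMR' hmod hAU hCM hGZK in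
/-- **`BSD(W, 2)` by print-transport for every globally minimal model of `4087a1^{(-31)}`** (`N = 3 927 607`; no root mod `31`, `decide`). CONDITIONAL;
BSD is NOT proved. [cite: Zhai2016, Thm. 1.1] [cite: MazurRubin2010, Lemma 2.10] [cite: CreutzMiller2012, Thm. 1.1] [cite: Miller2011LMS, Def. 1.1] -/
theorem bsdp_two_twist_4087a1_neg31 [NeZero (c4087a1.conductorNorm ℤ)]
    (Dt : ModularParametrizationData c4087a1 (c4087a1.conductorNorm ℤ)) (hopt : Zhai2021.IsOptimalDatum c4087a1 Dt)
    (hL : ∃ x : ℚ, IsLAlg c4087a1 x ∧ x ≠ 0 ∧ padicValRat 2 x = 0)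
    {c : VariableChange ℚ} (hc : c • c4087a1.quadraticTwist ((-31 : ℤ) : ℚ) = W) : BSDp W 2 :=
  haveI : Fact (Nat.Prime 31) := ⟨by norm_num⟩
  (bsdp_two_twist_4087a1_primeStar_of_forall_ne_zero W h11 h12 hMR' hmod hAU hCM hGZK Dt hopt hL (q := 31) (by norm_num) (by norm_num)
    forall_ne_zero_4087a1_31 (Or.inr (by norm_num)) (by decide) hc).2.2.2.2

include h11 h12 hMR' hmod hAU hCM hGZK in
/-- **`BSD(W, 2)` by print-transport for every globally minimal model of `4087a1^{(-43)}`** (`N = 7 556 863`; no root mod `43`, `decide`). CONDITIONAL;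
BSD is NOT proved. [cite: Zhai2016, Thm. 1.1] [cite: MazurRubin2010, Lemma 2.10] [cite: CreutzMiller2012, Thm. 1.1] [cite: Miller2011LMS, Def. 1.1] -/
theorem bsdp_two_twist_4087a1_neg43 [NeZero (c4087a1.conductorNorm ℤ)]
    (Dt : ModularParametrizationData c4087a1 (c4087a1.conductorNorm ℤ)) (hopt : Zhai2021.IsOptimalDatum c4087a1 Dt)
    (hL : ∃ x : ℚ, IsLAlg c4087a1 x ∧ x ≠ 0 ∧ padicValRat 2 x = 0)
    {c : VariableChange ℚ} (hc : c • c4087a1.quadraticTwist ((-43 : ℤ) : ℚ) = W) : BSDp W 2 :=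
  haveI : Fact (Nat.Prime 43) := ⟨by norm_num⟩
  (bsdp_two_twist_4087a1_primeStar_of_forall_ne_zero W h11 h12 hMR' hmod hAU hCM hGZK Dt hopt hL (q := 43) (by norm_num) (by norm_num)
    forall_ne_zero_4087a1_43 (Or.inr (by norm_num)) (by decide) hc).2.2.2.2

include h11 h12 hMR' hmod hAU hCM hGZK in
/-- **`BSD(W, 2)` by print-transport for every globally minimal model of `4087a1^{(53)}`** (`N = 11 480 383`; no root mod `53`, `decide`). CONDITIONAL;
BSD is NOT proved. [cite: Zhai2016, Thm. 1.1] [cite: MazurRubin2010, Lemma 2.10] [cite: CreutzMiller2012, Thm. 1.1] [cite: Miller2011LMS, Def. 1.1] -/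
theorem bsdp_two_twist_4087a1_53 [NeZero (c4087a1.conductorNorm ℤ)]
    (Dt : ModularParametrizationData c4087a1 (c4087a1.conductorNorm ℤ)) (hopt : Zhai2021.IsOptimalDatum c4087a1 Dt)
    (hL : ∃ x : ℚ, IsLAlg c4087a1 x ∧ x ≠ 0 ∧ padicValRat 2 x = 0)
    {c : VariableChange ℚ} (hc : c • c4087a1.quadraticTwist ((53 : ℤ) : ℚ) = W) : BSDp W 2 :=
  haveI : Fact (Nat.Prime 53) := ⟨by norm_num⟩
  (bsdp_two_twist_4087a1_primeStar_of_forall_ne_zero W h11 h12 hMR' hmod hAU hCM hGZK Dt hopt hL (q := 53) (by norm_num) (by norm_num)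
    forall_ne_zero_4087a1_53 (Or.inl (by norm_num)) (by decide) hc).2.2.2.2

end Members4087a1

/-! ## `4087c1` (`N = 4087`, model `[1, 1, 0, −4, 3]`): `a_q` odd from «no root of `4x³ + 5x² − 16x + 12` mod `q`» -/

/-- The `b`-invariants of the integral model of `4087c1`: `b₂ = 5`, `b₄ = -8`, `b₆ = 12`. [cite: CremonaAlgorithms1997, Table 1] -/
theorem integralModelInt_b_4087c1 : (integralModelInt c4087c1).b₂ = 5 ∧ (integralModelInt c4087c1).b₄ = -8 ∧
    (integralModelInt c4087c1).b₆ = 12 := by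
  have h : integralModelInt c4087c1 = M4087c1 := Instances.integralModelInt_baseChange_int M4087c1
  rw [h]
  exact ⟨by decide, by decide, by decide⟩

/-- **`a_q(4087c1)` odd from one `decide`**: for an odd prime `q ∤ 4087`, if `4x³ + 5x² − 16x + 12` has no root in `ℤ/q` then `a_q(4087c1)` is odd
(tree dictionary `TwoAdicTwistConverse.odd_frobeniusTrace_iff_forall_ne_zero`; good reduction at `q ∤ N = 4087`). [cite: SilvermanAEC2009, III.2.3 and V.2] -/
theorem odd_frobeniusTrace_4087c1_of_forall_ne_zero {q : ℕ} [Fact q.Prime] (hq2 : q ≠ 2) (hqN : ¬ q ∣ 4087)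
    (hno : ∀ x : ZMod q, 4 * x ^ 3 + 5 * x ^ 2 - 16 * x + 12 ≠ 0) : Odd (c4087c1.frobeniusTrace q) := by
  have hgood : c4087c1.HasGoodReductionAtPrime q := by
    by_contra h
    exact hqN (by rw [← conductorNorm_4087c1]; exact (c4087c1.dvd_conductorNorm_iff_not_hasGoodReductionAtPrime q).mpr h)
  rw [TwoAdicTwistConverse.odd_frobeniusTrace_iff_forall_ne_zero c4087c1 q hq2 hgood, integralModelInt_b_4087c1.1,
    integralModelInt_b_4087c1.2.1, integralModelInt_b_4087c1.2.2]
  intro x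
  have h := hno x
  push_cast
  intro h'
  apply h
  linear_combination h'

/-- No root of `4x³ + 5x² − 16x + 12` mod `7` (so `a_{7}(4087c1)` is odd). [cite: CremonaAlgorithms1997, Table 1] -/
theorem forall_ne_zero_4087c1_7 : ∀ x : ZMod 7, 4 * x ^ 3 + 5 * x ^ 2 - 16 * x + 12 ≠ 0 := by decide +kernel

/-- No root of `4x³ + 5x² − 16x + 12` mod `11` (so `a_{11}(4087c1)` is odd). [cite: CremonaAlgorithms1997, Table 1] -/
theorem forall_ne_zero_4087c1_11 : ∀ x : ZMod 11, 4 * x ^ 3 + 5 * x ^ 2 - 16 * x + 12 ≠ 0 := by decide +kernel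

/-- No root of `4x³ + 5x² − 16x + 12` mod `19` (so `a_{19}(4087c1)` is odd). [cite: CremonaAlgorithms1997, Table 1] -/
theorem forall_ne_zero_4087c1_19 : ∀ x : ZMod 19, 4 * x ^ 3 + 5 * x ^ 2 - 16 * x + 12 ≠ 0 := by decide +kernel

/-- No root of `4x³ + 5x² − 16x + 12` mod `31` (so `a_{31}(4087c1)` is odd). [cite: CremonaAlgorithms1997, Table 1] -/
theorem forall_ne_zero_4087c1_31 : ∀ x : ZMod 31, 4 * x ^ 3 + 5 * x ^ 2 - 16 * x + 12 ≠ 0 := by decide +kernel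

/-- No root of `4x³ + 5x² − 16x + 12` mod `43` (so `a_{43}(4087c1)` is odd). [cite: CremonaAlgorithms1997, Table 1] -/
theorem forall_ne_zero_4087c1_43 : ∀ x : ZMod 43, 4 * x ^ 3 + 5 * x ^ 2 - 16 * x + 12 ≠ 0 := by decide +kernel

/-- No root of `4x³ + 5x² − 16x + 12` mod `53` (so `a_{53}(4087c1)` is odd). [cite: CremonaAlgorithms1997, Table 1] -/
theorem forall_ne_zero_4087c1_53 : ∀ x : ZMod 53, 4 * x ^ 3 + 5 * x ^ 2 - 16 * x + 12 ≠ 0 := by decide +kernel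

section Members4087c1

variable (W : WeierstrassCurve ℚ) [W.IsElliptic] [W.IsGloballyMinimal]
  (h11 : thm11_ordTwo_LAlg_twist_eq_zero') (h12 : thm12_ordTwo_LAlg_twist_eq_one')
  (hMR' : MazurRubin2010.d2_eq_of_lemma210_rat) (hmod : exists_isNewformOf)
  (hAU : abbesUllmo_not_dvd_maninConstant_of_not_dvd_level)
  (hCM : bsdTriple_of_rank_le_one_of_conductor_lt) (hGZK : rank_eq_analyticRank_of_analyticRank_le_one)

include h11 h12 hMR' hmod hAU hCM hGZK in
/-- **`BSD(W, 2)` by PRINT-TRANSPORT for every globally minimal model `W` of `4087c1^{(d)}`, `d = ±q` a prime-star** (`q` an odd prime, `q ∤ 4087`,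
`d ∈ {q, −q}` with `d ≡ 1 (mod 4)`, and `4x³ + 5x² − 16x + 12` without root mod `q` — i.e. `a_q(4087c1)` odd, one `decide`): `r_an(W) = 0 ∧ rank 0 ∧
Ш(W)[2^∞] = 0 ∧ c(W)` odd `∧ BSD(W, 2)`, modulo PRINT⁷ {Zhai 1.1′/1.2′, Mazur–Rubin L. 2.10, modularity, Abbes–Ullmo, Creutz–Miller, GZK} +
displayed {`Dt`, `hL`} of `4087c1`. No Kato, no certificate. CONDITIONAL; BSD is NOT proved. [cite: Zhai2016, Thm. 1.1]
[cite: MazurRubin2010, Lemma 2.10] [cite: CreutzMiller2012, Thm. 1.1] [cite: AbbesUllmo1996, Thm. A] [cite: Miller2011LMS, Def. 1.1] -/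
theorem bsdp_two_twist_4087c1_primeStar_of_forall_ne_zero [NeZero (c4087c1.conductorNorm ℤ)]
    (Dt : ModularParametrizationData c4087c1 (c4087c1.conductorNorm ℤ)) (hopt : Zhai2021.IsOptimalDatum c4087c1 Dt)
    (hL : ∃ x : ℚ, IsLAlg c4087c1 x ∧ x ≠ 0 ∧ padicValRat 2 x = 0)
    {q : ℕ} [Fact q.Prime] (hq2 : q ≠ 2) (hqN : ¬ q ∣ 4087) (hno : ∀ x : ZMod q, 4 * x ^ 3 + 5 * x ^ 2 - 16 * x + 12 ≠ 0)
    {d : ℤ} (hd : d = q ∨ d = -q) (hd4 : d % 4 = 1)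
    {c : VariableChange ℚ} (hc : c • c4087c1.quadraticTwist (d : ℚ) = W) :
    W.analyticRank = 0 ∧ W.mordellWeilRank = 0 ∧ AddCommGroup.primaryComponent W.sha 2 = ⊥ ∧ Odd W.tamagawaProduct ∧ BSDp W 2 := by
  have hq : q.Prime := Fact.out
  have hdabs : d.natAbs = q := by rcases hd with rfl | rfl <;> simp
  have hsqf : Squarefree d := by
    rw [← Int.squarefree_natAbs, hdabs]; exact hq.squarefree
  have hd1 : d ≠ 1 := by
    rintro rfl
    rw [Int.natAbs_one] at hdabs
    exact hq.one_lt.ne hdabs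
  have hgcd : Int.gcd d 4087 = 1 := by
    rw [Int.gcd_eq_natAbs, hdabs]
    exact (Nat.Prime.coprime_iff_not_dvd hq).mpr hqN
  refine bsdp_two_twist_oddTrace_4087c1 W h11 h12 hMR' hmod hAU hCM hGZK Dt hopt hL hsqf hd1 hd4 hgcd (fun p hp hpd ↦ ?_) hc
  have hpq : p = q := by
    have h1 : p ∣ d.natAbs := Int.natCast_dvd.mp hpd
    rw [hdabs] at h1
    exact (Nat.prime_dvd_prime_iff_eq hp hq).mp h1
  subst hpq
  exact odd_frobeniusTrace_4087c1_of_forall_ne_zero hq2 hqN hno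

include h11 h12 hMR' hmod hAU hCM hGZK in
/-- **`BSD(W, 2)` by print-transport for every globally minimal model of `4087c1^{(-7)}`** (`N = 200 263`; no root mod `7`, `decide`). CONDITIONAL;
BSD is NOT proved. [cite: Zhai2016, Thm. 1.1] [cite: MazurRubin2010, Lemma 2.10] [cite: CreutzMiller2012, Thm. 1.1] [cite: Miller2011LMS, Def. 1.1] -/
theorem bsdp_two_twist_4087c1_neg7 [NeZero (c4087c1.conductorNorm ℤ)]
    (Dt : ModularParametrizationData c4087c1 (c4087c1.conductorNorm ℤ)) (hopt : Zhai2021.IsOptimalDatum c4087c1 Dt)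
    (hL : ∃ x : ℚ, IsLAlg c4087c1 x ∧ x ≠ 0 ∧ padicValRat 2 x = 0)
    {c : VariableChange ℚ} (hc : c • c4087c1.quadraticTwist ((-7 : ℤ) : ℚ) = W) : BSDp W 2 :=
  haveI : Fact (Nat.Prime 7) := ⟨by norm_num⟩
  (bsdp_two_twist_4087c1_primeStar_of_forall_ne_zero W h11 h12 hMR' hmod hAU hCM hGZK Dt hopt hL (q := 7) (by norm_num) (by norm_num)
    forall_ne_zero_4087c1_7 (Or.inr (by norm_num)) (by decide) hc).2.2.2.2

include h11 h12 hMR' hmod hAU hCM hGZK in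
/-- **`BSD(W, 2)` by print-transport for every globally minimal model of `4087c1^{(-11)}`** (`N = 494 527`; no root mod `11`, `decide`). CONDITIONAL;
BSD is NOT proved. [cite: Zhai2016, Thm. 1.1] [cite: MazurRubin2010, Lemma 2.10] [cite: CreutzMiller2012, Thm. 1.1] [cite: Miller2011LMS, Def. 1.1] -/
theorem bsdp_two_twist_4087c1_neg11 [NeZero (c4087c1.conductorNorm ℤ)]
    (Dt : ModularParametrizationData c4087c1 (c4087c1.conductorNorm ℤ)) (hopt : Zhai2021.IsOptimalDatum c4087c1 Dt)
    (hL : ∃ x : ℚ, IsLAlg c4087c1 x ∧ x ≠ 0 ∧ padicValRat 2 x = 0)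
    {c : VariableChange ℚ} (hc : c • c4087c1.quadraticTwist ((-11 : ℤ) : ℚ) = W) : BSDp W 2 :=
  haveI : Fact (Nat.Prime 11) := ⟨by norm_num⟩
  (bsdp_two_twist_4087c1_primeStar_of_forall_ne_zero W h11 h12 hMR' hmod hAU hCM hGZK Dt hopt hL (q := 11) (by norm_num) (by norm_num)
    forall_ne_zero_4087c1_11 (Or.inr (by norm_num)) (by decide) hc).2.2.2.2

include h11 h12 hMR' hmod hAU hCM hGZK in
/-- **`BSD(W, 2)` by print-transport for every globally minimal model of `4087c1^{(-19)}`** (`N = 1 475 407`; no root mod `19`, `decide`). CONDITIONAL;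
BSD is NOT proved. [cite: Zhai2016, Thm. 1.1] [cite: MazurRubin2010, Lemma 2.10] [cite: CreutzMiller2012, Thm. 1.1] [cite: Miller2011LMS, Def. 1.1] -/
theorem bsdp_two_twist_4087c1_neg19 [NeZero (c4087c1.conductorNorm ℤ)]
    (Dt : ModularParametrizationData c4087c1 (c4087c1.conductorNorm ℤ)) (hopt : Zhai2021.IsOptimalDatum c4087c1 Dt)
    (hL : ∃ x : ℚ, IsLAlg c4087c1 x ∧ x ≠ 0 ∧ padicValRat 2 x = 0)
    {c : VariableChange ℚ} (hc : c • c4087c1.quadraticTwist ((-19 : ℤ) : ℚ) = W) : BSDp W 2 :=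
  haveI : Fact (Nat.Prime 19) := ⟨by norm_num⟩
  (bsdp_two_twist_4087c1_primeStar_of_forall_ne_zero W h11 h12 hMR' hmod hAU hCM hGZK Dt hopt hL (q := 19) (by norm_num) (by norm_num)
    forall_ne_zero_4087c1_19 (Or.inr (by norm_num)) (by decide) hc).2.2.2.2

include h11 h12 hMR' hmod hAU hCM hGZK in
/-- **`BSD(W, 2)` by print-transport for every globally minimal model of `4087c1^{(-31)}`** (`N = 3 927 607`; no root mod `31`, `decide`). CONDITIONAL;
BSD is NOT proved. [cite: Zhai2016, Thm. 1.1] [cite: MazurRubin2010, Lemma 2.10] [cite: CreutzMiller2012, Thm. 1.1] [cite: Miller2011LMS, Def. 1.1] -/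
theorem bsdp_two_twist_4087c1_neg31 [NeZero (c4087c1.conductorNorm ℤ)]
    (Dt : ModularParametrizationData c4087c1 (c4087c1.conductorNorm ℤ)) (hopt : Zhai2021.IsOptimalDatum c4087c1 Dt)
    (hL : ∃ x : ℚ, IsLAlg c4087c1 x ∧ x ≠ 0 ∧ padicValRat 2 x = 0)
    {c : VariableChange ℚ} (hc : c • c4087c1.quadraticTwist ((-31 : ℤ) : ℚ) = W) : BSDp W 2 :=
  haveI : Fact (Nat.Prime 31) := ⟨by norm_num⟩
  (bsdp_two_twist_4087c1_primeStar_of_forall_ne_zero W h11 h12 hMR' hmod hAU hCM hGZK Dt hopt hL (q := 31) (by norm_num) (by norm_num)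
    forall_ne_zero_4087c1_31 (Or.inr (by norm_num)) (by decide) hc).2.2.2.2

include h11 h12 hMR' hmod hAU hCM hGZK in
/-- **`BSD(W, 2)` by print-transport for every globally minimal model of `4087c1^{(-43)}`** (`N = 7 556 863`; no root mod `43`, `decide`). CONDITIONAL;
BSD is NOT proved. [cite: Zhai2016, Thm. 1.1] [cite: MazurRubin2010, Lemma 2.10] [cite: CreutzMiller2012, Thm. 1.1] [cite: Miller2011LMS, Def. 1.1] -/
theorem bsdp_two_twist_4087c1_neg43 [NeZero (c4087c1.conductorNorm ℤ)]
    (Dt : ModularParametrizationData c4087c1 (c4087c1.conductorNorm ℤ)) (hopt : Zhai2021.IsOptimalDatum c4087c1 Dt)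
    (hL : ∃ x : ℚ, IsLAlg c4087c1 x ∧ x ≠ 0 ∧ padicValRat 2 x = 0)
    {c : VariableChange ℚ} (hc : c • c4087c1.quadraticTwist ((-43 : ℤ) : ℚ) = W) : BSDp W 2 :=
  haveI : Fact (Nat.Prime 43) := ⟨by norm_num⟩
  (bsdp_two_twist_4087c1_primeStar_of_forall_ne_zero W h11 h12 hMR' hmod hAU hCM hGZK Dt hopt hL (q := 43) (by norm_num) (by norm_num)
    forall_ne_zero_4087c1_43 (Or.inr (by norm_num)) (by decide) hc).2.2.2.2

include h11 h12 hMR' hmod hAU hCM hGZK in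
/-- **`BSD(W, 2)` by print-transport for every globally minimal model of `4087c1^{(53)}`** (`N = 11 480 383`; no root mod `53`, `decide`). CONDITIONAL;
BSD is NOT proved. [cite: Zhai2016, Thm. 1.1] [cite: MazurRubin2010, Lemma 2.10] [cite: CreutzMiller2012, Thm. 1.1] [cite: Miller2011LMS, Def. 1.1] -/
theorem bsdp_two_twist_4087c1_53 [NeZero (c4087c1.conductorNorm ℤ)]
    (Dt : ModularParametrizationData c4087c1 (c4087c1.conductorNorm ℤ)) (hopt : Zhai2021.IsOptimalDatum c4087c1 Dt)
    (hL : ∃ x : ℚ, IsLAlg c4087c1 x ∧ x ≠ 0 ∧ padicValRat 2 x = 0)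
    {c : VariableChange ℚ} (hc : c • c4087c1.quadraticTwist ((53 : ℤ) : ℚ) = W) : BSDp W 2 :=
  haveI : Fact (Nat.Prime 53) := ⟨by norm_num⟩
  (bsdp_two_twist_4087c1_primeStar_of_forall_ne_zero W h11 h12 hMR' hmod hAU hCM hGZK Dt hopt hL (q := 53) (by norm_num) (by norm_num)
    forall_ne_zero_4087c1_53 (Or.inl (by norm_num)) (by decide) hc).2.2.2.2

end Members4087c1

end Summit.BirchSwinnertonDyer.BirchSwinnertonDyer.Theorems.AlignedTransportAtTwoTwistFamilyZhaiTransportMembers4087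

end
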